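import Mathlib

/-!
# `Balaban1983to89.B16Sect1Kernels` — T. Bałaban, *Large field renormalization. II. Localization, exponentiation, and
bounds for the 𝐑 operation*, Commun. Math. Phys. **122**, 355–392 (1989) [Balaban1989LargeFieldII] (cell paper B16;
PDF held `paper:balaban1989-cmp122-large-field-ii`, journal page = PDF page + 354): three ELEMENTARY KERNELS of §1 the
text uses without display of proof — the contraction scheme of p. 359 (proof of Proposition 1 of
[Balaban1989LargeFieldI]) and of (1.40)–(1.41) p. 367; the Mayer expansion step behind (1.90)–(1.91) p. 388 (*"the same
as in (7.1) [I]"*); and, as quoted leaves, the large-field geometry (1.76) p. 381 and the local quadratic-form bounds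
(1.77)–(1.78) p. 383 (mega-formalization `lit-balaban`, reader/typer block r13, second module; the first is
`…B16Sect1Wilson`).

Statement-level skeleton of published theorems with citation tags; proofs where landed; nothing here is a claim about
the Yang–Mills mass gap.

WHAT IS HERE.  (a) `fixedPoint_twice_bound` — PROVED: in a complete normed group, the equation `x + K(x) = c` with `K(0) =
0` and `K` ½-Lipschitz on the closed ball of radius `2‖c‖` has exactly one solution in that ball; this is the sentence
p. 359 [5] *"Using Proposition 4 [15] and the fixed point theorem for contractive mappings, we can easily prove that the
above equation has exactly one solution, which has a bound equal to twice a bound of the right-hand side of the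
equation"* applied to (1.13) (and again to (1.40) on p. 367), with the Lipschitz smallness that Proposition 4 of
[Balaban1985Variational] supplies there made the explicit hypothesis `hLip` (Banach's fixed point theorem from Mathlib,
`ContractingWith.fixedPoint`, on the complete subtype `closedBall 0 (2‖c‖)`).  (b) `exp_sum_eq_sum_powerset` and
`exp_sum_eq_mayer` — PROVED: `exp Σ_{Y∈𝒟} V(Y) = Σ_{D⊆𝒟} Π_{Y∈D}(e^{V(Y)} − 1) = Σ_{D⊆𝒟} Π_{Y∈D} ∫₀¹dt V(Y)e^{tV(Y)}`, the
algebra producing the activities (1.91) from the exponential `exp Σ_Y V(Y, U_k)` of (1.72) (the regrouping of the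
`D`-terms into connected components `X′_p`, i.e. (1.90) proper, and the convergence (1.97) ⇒ (1.98) are the sibling
modules `…B16Ineq197`, `…B16Exp198`).  (c) Quoted leaves: (1.76) as a set inclusion over abstract enlargement maps;
(1.77), (1.78) as bound shapes over the printed constants, and the large-field factor sentence after (1.78) as
arithmetic (`Ineq177`, `Ineq178`, `lfFactor178`).

Quotations (1.77)–(1.79) and (1.90)–(1.93) were re-read by this seat on the renders p029, p034 of
`run/shared/lean/pub/pub-balaban/b2b-balaban-ref1/pages/1989-cmp122-large-field-II/`; p. 359 on p005; (1.76) is quoted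
from the cell module `…B16MergeGeometry` (render p027 re-read there) and the cell transcript
`HOME/b2b-balaban-b02/B16-transcript.md`.
-/

namespace Literature.MathematicalPhysics.QuantumFieldTheory.Balaban1983to89.B16Sect1Kernels

open Finset

/-! ## §1. p. 359 / (1.40)–(1.41): "exactly one solution, with a bound equal to twice a bound of the right-hand side" -/

/-- p. 359 [5] (render p005), the contraction scheme of the proof of Proposition 1 [IV], verbatim: *"Equation (1.12) can
be written as B′ + (P₀H*_{1,k}Δ₁H_{1,k}P₀)^{−1}P₀H*_{1,k}((δ/δA)V)(H_{1,k}B′) = −(P₀H*_{1,k}Δ₁H_{1,k}P₀)^{−1}P₀H*_{1,k}J_{k,Z}.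
(1.13) Using Proposition 4 [15] and the fixed point theorem for contractive mappings, we can easily prove that the above
equation has exactly one solution, which has a bound equal to twice a bound of the right-hand side of the equation,
i.e., it can be bounded by 2γ₀^{−1}2d(100M)⁵B₃²4ε_k. This proves the existence and the uniqueness statements of
Proposition 1 [IV], and the bound (1.78) [IV]."*  The abstract statement PROVED here: `x + K x = c`, `K 0 = 0`, `K`
½-Lipschitz on the closed ball of radius `2‖c‖` ⇒ exactly one solution `x` with `‖x‖ ≤ 2‖c‖` (the Lipschitz constant ½
on that ball is what "Proposition 4 [15]" = [Balaban1985Variational] Prop. 4 (97)–(98) gives for `(δ/δA)V`, quadratic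
at 0, when `ε_k` is small at fixed `M` — cell transcript [chk-1] at p. 359; the same scheme yields (1.41) p. 367 for
(1.40)).  Uniqueness is within the ball, as in the text ("a small configuration"). [cite: Balaban1989LargeFieldII, p.359 (after (1.13))] -/
theorem fixedPoint_twice_bound {E : Type*} [NormedAddCommGroup E] [CompleteSpace E] (K : E → E) (c : E)
    (hK0 : K 0 = 0)
    (hLip : ∀ x y : E, ‖x‖ ≤ 2 * ‖c‖ → ‖y‖ ≤ 2 * ‖c‖ → ‖K x - K y‖ ≤ 1 / 2 * ‖x - y‖) :
    ∃ x : E, (‖x‖ ≤ 2 * ‖c‖ ∧ x + K x = c) ∧ ∀ y : E, ‖y‖ ≤ 2 * ‖c‖ → y + K y = c → y = x := by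
  set r : ℝ := 2 * ‖c‖ with hr
  have hr0 : 0 ≤ r := by rw [hr]; positivity
  let S : Set E := Metric.closedBall 0 r
  have hmem : ∀ {x : E}, x ∈ S ↔ ‖x‖ ≤ r := fun {x} => by
    simp only [S, Metric.mem_closedBall, dist_zero_right]
  have hmaps : ∀ x ∈ S, c - K x ∈ S := by
    intro x hx
    rw [hmem] at hx ⊢
    have h1 : ‖K x‖ ≤ 1 / 2 * ‖x‖ := by
      have := hLip x 0 hx (by rw [norm_zero]; exact hr0)
      simpa [hK0] using this
    calc ‖c - K x‖ ≤ ‖c‖ + ‖K x‖ := norm_sub_le _ _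
      _ ≤ ‖c‖ + 1 / 2 * r := by nlinarith [h1, hx]
      _ = r := by rw [hr]; ring
  haveI : CompleteSpace S := Metric.isClosed_closedBall.completeSpace_coe
  haveI : Nonempty S := ⟨⟨0, hmem.2 (by rw [norm_zero]; exact hr0)⟩⟩
  let g : S → S := fun x => ⟨c - K x, hmaps x x.2⟩
  have hg : ContractingWith (1 / 2) g := by
    refine ⟨by rw [← NNReal.coe_lt_coe]; push_cast; norm_num, LipschitzWith.of_dist_le_mul fun x y => ?_⟩
    rw [Subtype.dist_eq, Subtype.dist_eq, dist_eq_norm, dist_eq_norm]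
    have hxy := hLip x y (hmem.1 x.2) (hmem.1 y.2)
    have e : ((g x : S) : E) - (g y : E) = -(K x - K y) := by
      show (c - K x) - (c - K y) = -(K x - K y)
      abel
    rw [e, norm_neg]
    push_cast
    exact hxy
  set xstar := ContractingWith.fixedPoint g hg with hxstar
  have hfix : g xstar = xstar := hg.fixedPoint_isFixedPt
  refine ⟨xstar, ⟨hmem.1 xstar.2, ?_⟩, ?_⟩
  · have h1 : c - K (xstar : E) = (xstar : E) := congrArg Subtype.val hfix
    exact (sub_eq_iff_eq_add.mp h1).symm
  · intro y hy hyeq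
    have hyS : y ∈ S := hmem.2 hy
    have hfy : Function.IsFixedPt g ⟨y, hyS⟩ := by
      apply Subtype.ext
      show c - K y = y
      rw [← hyeq]
      abel
    exact congrArg Subtype.val (hg.fixedPoint_unique hfy)

/-! ## §2. (1.90)–(1.91): the Mayer expansion step -/

/-- The algebra of the Mayer expansion, PROVED: `exp Σ_{Y∈𝒟} V(Y) = Π_Y (1 + (e^{V(Y)} − 1)) = Σ_{D⊆𝒟} Π_{Y∈D}(e^{V(Y)} −
1)` — p. 387 [33]: *"Let us start with the Mayer expansion of the last exponential, the same as in (7.1) [I]"* ((7.1) [I] =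
(2.1) of [Balaban1988RG2Cluster], cell DIVERGENCE D-T1b), the first step towards (1.90)–(1.91) p. 388. [cite: Balaban1989LargeFieldII, (1.90)–(1.91) p.388] -/
theorem exp_sum_eq_sum_powerset {ι : Type*} (s : Finset ι) (V : ι → ℝ) :
    Real.exp (∑ Y ∈ s, V Y) = ∑ D ∈ s.powerset, ∏ Y ∈ D, (Real.exp (V Y) - 1) := by
  rw [Real.exp_sum, ← Finset.prod_one_add]
  exact Finset.prod_congr rfl fun Y _ => by ring

/-- The interpolation producing the `∫₀¹dt(Y)` of (1.91), PROVED: `e^{v} − 1 = ∫₀¹ v e^{tv} dt`. [cite: Balaban1989LargeFieldII, (1.91) p.388] -/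
theorem expm1_eq_integral (v : ℝ) : Real.exp v - 1 = ∫ t in (0 : ℝ)..1, v * Real.exp (t * v) := by
  have hder : ∀ t ∈ Set.uIcc (0 : ℝ) 1, HasDerivAt (fun t : ℝ => Real.exp (t * v)) (Real.exp (t * v) * v) t :=
    fun t _ => (hasDerivAt_mul_const v).exp
  have hint : IntervalIntegrable (fun t : ℝ => Real.exp (t * v) * v) MeasureTheory.volume 0 1 :=
    (by fun_prop : Continuous fun t : ℝ => Real.exp (t * v) * v).intervalIntegrable 0 1
  have h := intervalIntegral.integral_eq_sub_of_hasDerivAt hder hint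
  simp only [one_mul, zero_mul, Real.exp_zero] at h
  rw [show (fun t : ℝ => v * Real.exp (t * v)) = fun t : ℝ => Real.exp (t * v) * v from
    funext fun _ => mul_comm _ _, h]

/-- **(1.90)–(1.91)** p. 388 [34] (render p034), the Mayer step, verbatim context: *"We obtain the following polymer
expansion {⋯} = 1 + Σ_{r≥1} Σ_{{X′₁,…,X′_r}} Π_{p=1}^{r} F(X′_p), (1.90) where the activities F(X′) are defined by F(X′) =
Σ_q Σ′_{{X_{j₁},…,X_{j_q}}} Σ′_𝐃 Π_{Y∈𝐃} ∫₀¹dt(Y) Π_{h=1}^{q} 𝐓′_k(X_{j_h}) Π_{Y∈𝐃} V(Y) exp Σ_{Y∈𝐃} t(Y)V(Y). (1.91) Here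
the summation is over {X_{j₁},…,X_{j_q}} and 𝐃 such that the connected localization domain they determine is equal to
X′."*  PROVED here: the identity generating the `𝐃`-terms with their `t(Y)`-integrals from the exponential `exp Σ_Y
V(Y, U_k)` of (1.72): `exp Σ_{Y∈𝒟} V(Y) = Σ_{𝐃⊆𝒟} Π_{Y∈𝐃} ∫₀¹dt V(Y)e^{tV(Y)}` (for real `V`; the `𝐃 = ∅` term is the
printed `1`).  The regrouping into connected components `X′_p` and the operations `𝐓′_k(X_{j_h})` are not modelled
(siblings `…B16Ineq197`, `…B16Exp198`). [cite: Balaban1989LargeFieldII, (1.90)–(1.91) p.388] -/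
theorem exp_sum_eq_mayer {ι : Type*} (s : Finset ι) (V : ι → ℝ) :
    Real.exp (∑ Y ∈ s, V Y) = ∑ D ∈ s.powerset, ∏ Y ∈ D, ∫ t in (0 : ℝ)..1, V Y * Real.exp (t * V Y) := by
  rw [exp_sum_eq_sum_powerset]
  exact Finset.sum_congr rfl fun D _ => Finset.prod_congr rfl fun Y _ => expm1_eq_integral (V Y)

/-- The printed leading `1` of (1.90): the `𝐃 = ∅` term split off, `exp Σ_{Y∈𝒟} V(Y) = 1 + Σ_{∅≠𝐃⊆𝒟} Π_{Y∈𝐃}(e^{V(Y)} − 1)`.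
PROVED. [cite: Balaban1989LargeFieldII, (1.90) p.388] -/
theorem exp_sum_eq_one_add {ι : Type*} [DecidableEq ι] (s : Finset ι) (V : ι → ℝ) :
    Real.exp (∑ Y ∈ s, V Y) = 1 + ∑ D ∈ s.powerset.erase ∅, ∏ Y ∈ D, (Real.exp (V Y) - 1) := by
  rw [exp_sum_eq_sum_powerset, ← Finset.add_sum_erase _ _ (Finset.empty_mem_powerset s), Finset.prod_empty]

/-! ## §3. Quoted leaves: (1.76) and (1.77)–(1.78) with the large-field factor -/

/-- **(1.76)** p. 381 [27], verbatim (as re-read in the cell module `…B16MergeGeometry` on render p027): *"Z_j ⊂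
Z′_{j−1}^{~10} ∪ ⋃_i (Z_j^{(i)})^{~2}"* — the cell transcript: *"important property", stated without argument
(definitional from [IV] §1's construction of Z_j)*; used on p. 386 to derive (1.84).  Typed over an abstract point type
with the two enlargement operations `~10` (ten layers of `LMR_j`-cubes, in the coarse cover `Z′`) and `~2` as maps. [cite: Balaban1989LargeFieldII, (1.76) p.381] -/
def Incl176 {α ι : Type*} (enl10 enl2 : Set α → Set α) (Zprev : Set α) (Znew : ι → Set α) (Zj : Set α) : Prop :=
  Zj ⊆ enl10 Zprev ∪ ⋃ i, enl2 (Znew i)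

/-- **(1.77)** p. 383 [29], verbatim (render p029): *"Using the local version of the bound (1.7) we can bound this quadratic
form from below by γ₀ Σ_{p′∈𝔹₀∩Ω″~_{h+1}} |(∂B)(p′)|². Thus we obtain the inequality ⟨DH″_{1,j,Z}B, ζDH″_{1,j,Z}B⟩ > γ₀
Σ_{p′∈𝔹₀∩Ω″~_{h+1}} |(∂B)(p′)|² − O(1)A₀A₁²B₃⁴B₅M^{d+6}R_j^{d+3}p₀(g_j)p₁²(g_j)g_j. (1.77) We assume that g_j is
sufficiently small, so that the constant on the right-hand side above is small, or O(1)."* — `Q` the form, `ndB` the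
plaquette sum, the `O(1)` an explicit `C`; `p₀g`, `p₁g` = `p₀(g_j)`, `p₁(g_j)`. [cite: Balaban1989LargeFieldII, (1.77) p.383] -/
def Ineq177 (Q ndB γ₀ C A₀ A₁ B₃ B₅ M Rj p₀g p₁g gj : ℝ) (d : ℕ) : Prop :=
  γ₀ * ndB - C * A₀ * A₁ ^ 2 * B₃ ^ 4 * B₅ * M ^ (d + 6) * Rj ^ (d + 3) * p₀g * p₁g ^ 2 * gj < Q

/-- **(1.78)** p. 383 [29], verbatim (render p029): *"We have to bound one bond variable |B(b)|² by the quadratic form. By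
the same remark as in the case of the inequality (1.8), we get |B(b)|² ≦ 6(d + 3)(100M(L + 1)N^{β₀}R_j)^{d+2}
Σ_{p′∈𝔹₀∩Ω″~_{h+1}} |(∂B)(p′)|², (1.78) for a bond b ∈ 𝔹₀ ∩ Ω″~_{h+1}."* — `nb` = `|B(b)|²`, `ndB` the plaquette sum. [cite: Balaban1989LargeFieldII, (1.78) p.383] -/
def Ineq178 (nb ndB M L Nβ Rj : ℝ) (d : ℕ) : Prop :=
  nb ≤ 6 * (d + 3) * (100 * M * (L + 1) * Nβ * Rj) ^ (d + 2) * ndB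

/-- p. 383 [29] (render p029), the large-field factor drawn from (1.77)–(1.78), verbatim: *"We take the bond b, for which
|B(b)| ≧ g_j^{−1}δ′_j = A₁p₁(g_j), and the inequalities (1.77), (1.78) yield the following large field factor:
exp(−½γ₀[6(d + 3)(100M(L + 1)N^{β₀}R_j)^{d+2}]^{−1}A₁²p₁(g_j)) < exp(−R_j^{−d−5}p₁²(g_j)). This is the largest factor
among all the small factors … We assume that 2p₁ − (d + 5)r₀ > p₀, and we estimate the factors by exp(−p₀(g_j))."* — the
displayed comparison of exponents as a `Prop` (`W` = `6(d+3)(100M(L+1)N^{β₀}R_j)^{d+2}`; the left exponent carries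
`p₁(g_j)` as printed where `p₁²(g_j)` is meant — cell transcript slip note D-b02.7 — so both readings are parameters here:
`p₁g'` is the printed left factor). [cite: Balaban1989LargeFieldII, p.383 (after (1.78))] -/
def lfFactor178 (γ₀ W A₁ p₁g' p₁g Rj : ℝ) (d : ℕ) : Prop :=
  Real.exp (-(1 / 2) * γ₀ * W⁻¹ * A₁ ^ 2 * p₁g') < Real.exp (-(Rj ^ (d + 5))⁻¹ * p₁g ^ 2)

/-- The bond selected in that sentence feeds (1.78) into (1.77): a bond with `|B(b)|² ≥ (A₁p₁(g_j))²` forces the plaquette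
sum, hence the form, to be large — `Q > γ₀ W⁻¹ (A₁p₁(g_j))² − c` when `|B(b)|² ≤ W·Σ|∂B|²` (1.78) and `Q > γ₀Σ|∂B|² − c`
(1.77).  PROVED (arithmetic; `W > 0`, `γ₀ ≥ 0`). [cite: Balaban1989LargeFieldII, p.383 (after (1.78))] -/
theorem form_lower_of_large_bond {Q ndB nb γ₀ W c a : ℝ} (hW : 0 < W) (hγ : 0 ≤ γ₀)
    (h78 : nb ≤ W * ndB) (h77 : γ₀ * ndB - c < Q) (hb : a ^ 2 ≤ nb) :
    γ₀ * W⁻¹ * a ^ 2 - c < Q := by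
  have h1 : W⁻¹ * a ^ 2 ≤ ndB := by
    rw [inv_mul_le_iff₀ hW]
    exact hb.trans h78
  nlinarith [mul_le_mul_of_nonneg_left h1 hγ]


/-! ## §4 (v2, append-only). The N-window of §1: p. 361 «N ≤ R_k» and p. 363 «L^{−N} ≤ (log g_k^{−2})^{−ν}»
(INTERFACES PULL (P2) of the T⁴ spine row NE7b, `lit-balaban/INBOX.md` 2026-08-20T22:21:17Z; SKELETON rows B16.Txt@361, B16.Lem@363) -/

/-- **p. 361 [7], the upper end of the N-window**, verbatim (OCR p0007 l.10 + cell transcript render p007): after the bound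
`O(1)|𝔅₀|δ′_k³ ≦ O(1)(100MR_k)^dN²δ′_k³ ≦ g_k³O(1)M^dR_k^{d+2}A₁³p₁³(g_k)` of the third-order term of (1.20): *"and dividing the
number on the right-hand side by g_k² we get still a small number, if g_k is small enough. We have assumed here that
N ≦ R_k."* — the standing assumption on the number `N` of preliminary steps (`h = k − N`, [IV] §1) against `R_k` of
[III] (2.5). [cite: Balaban1989LargeFieldII, p.361 (after (1.20))] -/
def NWindowUpper (N : ℕ) (Rk : ℝ) : Prop := (N : ℝ) ≤ Rk

/-- **p. 363 [9], the lower end of the N-window**, verbatim (OCR p0009 ll.28–30 + cell transcript render p009): *"The number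
multiplying g_k² is small if L^{−N} is small enough, for example if L^{−N} ≦ (log g_k^{−2})^{−ν} for sufficiently large ν,
or N ≧ (ν/log L) log log g_k^{−2}. For the smallness of the above bound we need ν ≧ 2p₀ + dr₀."* — the displayed-in-text
condition, with `ℓ` standing for `log g_k^{−2}` (real powers). [cite: Balaban1989LargeFieldII, p.363 (after (1.29))] -/
def NWindowLower (L : ℝ) (N : ℕ) (ℓ ν : ℝ) : Prop := L ^ (-(N : ℝ)) ≤ ℓ ^ (-ν)

/-- p. 363 [9]: the printed alternative form *"or N ≧ (ν/log L) log log g_k^{−2}"* IMPLIES `NWindowLower` (for `L > 1` and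
`ℓ = log g_k^{−2} > 0`). PROVED (take logarithms). [cite: Balaban1989LargeFieldII, p.363 (after (1.29))] -/
theorem nWindowLower_of_log {L ℓ ν : ℝ} {N : ℕ} (hL : 1 < L) (hℓ : 0 < ℓ)
    (hN : ν * Real.log ℓ / Real.log L ≤ N) : NWindowLower L N ℓ ν := by
  unfold NWindowLower
  have hlogL : 0 < Real.log L := Real.log_pos hL
  rw [Real.rpow_def_of_pos (by linarith), Real.rpow_def_of_pos hℓ, Real.exp_le_exp]
  have h := (div_le_iff₀ hlogL).mp hN
  nlinarith

/-- p. 363 [9]: *"For the smallness of the above bound we need ν ≧ 2p₀ + dr₀"* (p₀, r₀ the exponents of `p₀(g) =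
A₀(log g^{−2})^{p₀}` and `R_k ~ (log g_k^{−2})^{r₀}`; the cell's sharpened list of such ν-conditions is GAPS G-B16-03 — p. 368
"the usual conditions on N" needs `ν > p₀ + q₁ + 7r₀`, etc.; only the printed one is typed). [cite: Balaban1989LargeFieldII, p.363 (after (1.29))] -/
def NuCondition363 (ν p₀ r₀ : ℝ) (d : ℕ) : Prop := 2 * p₀ + d * r₀ ≤ ν

/-- The N-WINDOW of §1 (both printed ends): `L^{−N} ≤ (log g_k^{−2})^{−ν}` (p. 363) and `N ≤ R_k` (p. 361); p. 368: *"This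
problem dictates some basic aspects of the 𝐑-operation, for example it determines the number N"*. [cite: Balaban1989LargeFieldII, p.361 and p.363] -/
def NWindow (L : ℝ) (N : ℕ) (ℓ ν Rk : ℝ) : Prop := NWindowLower L N ℓ ν ∧ NWindowUpper N Rk


/-! ## §5 (v3, append-only). (1.31): the printed right-hand side from the text's four inputs (arithmetic) -/

/-- **(1.31)** p. 364 [10] (render p010 re-read by this seat): *"0 ≦ A(ζ₁, U₀) < g_k²L^{−4N}N^{4β₀}O(1)A₀²B₃²B₅²M^{14}R_k⁴
p₀²(g_k)"* — the ARITHMETIC assembling the printed right-hand side from the four inputs the text uses (cell transcript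
[CERT arithmetic] at (1.31)), each an explicit hypothesis here: the number `nS` of η-plaquettes in `supp ζ₁ ⊂ Z″_{h+1}`
is `≤ O(1)M⁴R_{h+1}⁴L^{−4N}η^{−4}` (`hS`, `Lm4N` = L^{−4N}); the per-plaquette term is `c = (O(1)B₃B₅M⁵ε_kη²)²` from
(1.80) [IV] (`hc`); `ε_k = g_kA₀p₀(g_k)` ([III] (2.2), `hε`); `R_{h+1} ≤ O(1)N^{β₀}R_k` (`hR`, `Nb` = N^{β₀}).  Then
`A(ζ₁,U₀) ≤ c·nS` (`…B16Sect1Wilson.wilsonLoc_le_card_mul`) is at most the printed expression with O(1) = C₁C₂²C₃⁴.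
PROVED. [cite: Balaban1989LargeFieldII, (1.31) p.364] -/
theorem ineq131_arith {nS c C₁ C₂ C₃ M Rh Rk Lm4N Nb B₃ B₅ εk η gk A₀ p₀ : ℝ}
    (hC₁ : 0 ≤ C₁) (hM : 0 ≤ M) (hRh : 0 ≤ Rh) (hL : 0 ≤ Lm4N) (hη : η ≠ 0)
    (hS : nS ≤ C₁ * M ^ 4 * Rh ^ 4 * Lm4N * (η ^ 4)⁻¹) (hc : c = (C₂ * B₃ * B₅ * M ^ 5 * εk * η ^ 2) ^ 2)
    (hε : εk = gk * A₀ * p₀) (hR : Rh ≤ C₃ * Nb * Rk) :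
    c * nS ≤ gk ^ 2 * Lm4N * Nb ^ 4 * (C₁ * C₂ ^ 2 * C₃ ^ 4) * A₀ ^ 2 * B₃ ^ 2 * B₅ ^ 2 * M ^ 14 * Rk ^ 4 * p₀ ^ 2 := by
  have hη4 : η ^ 4 ≠ 0 := pow_ne_zero 4 hη
  have hη4nn : 0 ≤ (η ^ 4)⁻¹ := inv_nonneg.mpr (Even.pow_nonneg (by decide) η)
  have hc0 : 0 ≤ c := by rw [hc]; exact sq_nonneg _
  have h2 : Rh ^ 4 ≤ (C₃ * Nb * Rk) ^ 4 := pow_le_pow_left₀ hRh hR 4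
  have hX : 0 ≤ C₁ * M ^ 4 * Lm4N * (η ^ 4)⁻¹ :=
    mul_nonneg (mul_nonneg (mul_nonneg hC₁ (pow_nonneg hM 4)) hL) hη4nn
  have hcX : c * (C₁ * M ^ 4 * Lm4N * (η ^ 4)⁻¹) = (C₂ * B₃ * B₅ * M ^ 5 * εk) ^ 2 * (C₁ * M ^ 4 * Lm4N) := by
    rw [hc]
    calc (C₂ * B₃ * B₅ * M ^ 5 * εk * η ^ 2) ^ 2 * (C₁ * M ^ 4 * Lm4N * (η ^ 4)⁻¹)
        = (C₂ * B₃ * B₅ * M ^ 5 * εk) ^ 2 * (C₁ * M ^ 4 * Lm4N) * (η ^ 4 * (η ^ 4)⁻¹) := by ring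
      _ = (C₂ * B₃ * B₅ * M ^ 5 * εk) ^ 2 * (C₁ * M ^ 4 * Lm4N) := by rw [mul_inv_cancel₀ hη4, mul_one]
  calc c * nS ≤ c * (C₁ * M ^ 4 * Rh ^ 4 * Lm4N * (η ^ 4)⁻¹) := mul_le_mul_of_nonneg_left hS hc0
    _ = (c * (C₁ * M ^ 4 * Lm4N * (η ^ 4)⁻¹)) * Rh ^ 4 := by ring
    _ ≤ (c * (C₁ * M ^ 4 * Lm4N * (η ^ 4)⁻¹)) * (C₃ * Nb * Rk) ^ 4 :=
        mul_le_mul_of_nonneg_left h2 (mul_nonneg hc0 hX)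
    _ = (C₂ * B₃ * B₅ * M ^ 5 * εk) ^ 2 * (C₁ * M ^ 4 * Lm4N) * (C₃ * Nb * Rk) ^ 4 := by rw [hcX]
    _ = gk ^ 2 * Lm4N * Nb ^ 4 * (C₁ * C₂ ^ 2 * C₃ ^ 4) * A₀ ^ 2 * B₃ ^ 2 * B₅ ^ 2 * M ^ 14 * Rk ^ 4 * p₀ ^ 2 := by
        subst hε
        ring


/-! ## §6 (v4, append-only). p. 383: the exponent proviso «2p₁ − (d + 5)r₀ > p₀» next to `lfFactor178`
(INTERFACES.md §1 row NE7b, owner NEED C7, `lit-balaban/INBOX.md` 2026-08-20T22:55Z; SKELETON row B16.Txt@383) -/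

/-- **p. 383 [29], the exponent proviso** (render p029 re-read by this seat), verbatim — the sentence following the
large-field factor drawn from (1.77)–(1.78) (`lfFactor178`): *"This is the largest factor among all the small factors
we have obtained from the large field characteristic functions in the preparatory steps. We assume that 2p₁ − (d + 5)r₀
> p₀, and we estimate the factors by exp(−p₀(g_j))."* — the printed condition on the three exponents `p₀`, `p₁`, `r₀`
(of `p₀(g) = (log g⁻²)^{p₀}`, `p₁(g) = (log g⁻²)^{p₁}` and `R_j = (log g_j⁻²)^{r₀}`, [III] (2.2)–(2.5)) and the dimension
`d`, as a display `Prop`; nothing about its use is asserted here (the cell's own readings of «p₀ large» are NOT this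
row). [cite: Balaban1989LargeFieldII, p.383 (after (1.78))] -/
def ExponentProviso383 (p₀ p₁ r₀ : ℝ) (d : ℕ) : Prop :=
  p₀ < 2 * p₁ - (d + 5) * r₀

/-- What the proviso buys, PROVED (real arithmetic): reading `p₀(g_j) = ℓ^{p₀}`, `p₁(g_j) = ℓ^{p₁}`, `R_j = ℓ^{r₀}` with
`ℓ = log g_j⁻² ≥ 1`, the proviso `2p₁ − (d + 5)r₀ > p₀` gives `p₀(g_j) ≤ R_j^{−d−5}p₁²(g_j)`, i.e. the right-hand side of
`lfFactor178` is at most the factor the text keeps: `exp(−R_j^{−d−5}p₁²(g_j)) ≤ exp(−p₀(g_j))` — *"and we estimate the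
factors by exp(−p₀(g_j))"*. [cite: Balaban1989LargeFieldII, p.383 (after (1.78))] -/
theorem exp_lfFactor_le_exp_neg_p0 {ℓ p₀ p₁ r₀ p₀g p₁g Rj : ℝ} {d : ℕ} (hℓ : 1 ≤ ℓ)
    (hp₀ : p₀g = ℓ ^ p₀) (hp₁ : p₁g = ℓ ^ p₁) (hR : Rj = ℓ ^ r₀) (h : ExponentProviso383 p₀ p₁ r₀ d) :
    Real.exp (-(Rj ^ (d + 5))⁻¹ * p₁g ^ 2) ≤ Real.exp (-p₀g) := by
  unfold ExponentProviso383 at h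
  have hℓ0 : 0 < ℓ := by linarith
  have key : p₀g ≤ (Rj ^ (d + 5))⁻¹ * p₁g ^ 2 := by
    have e1 : (Rj ^ (d + 5))⁻¹ * p₁g ^ 2 = ℓ ^ (2 * p₁ - (d + 5) * r₀) := by
      rw [hR, hp₁, ← Real.rpow_natCast (ℓ ^ r₀) (d + 5), ← Real.rpow_mul hℓ0.le,
        ← Real.rpow_neg hℓ0.le, ← Real.rpow_natCast (ℓ ^ p₁) 2, ← Real.rpow_mul hℓ0.le,
        ← Real.rpow_add hℓ0]
      congr 1
      push_cast
      ring
    rw [e1, hp₀]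
    exact Real.rpow_le_rpow_of_exponent_le hℓ h.le
  exact Real.exp_le_exp.mpr (by linarith)


/-! ## §7 (v5, append-only). p. 383: the displayed comparison of exponents `lfFactor178`, PROVED under the explicit
largeness of `R_j` the text calls «g_j sufficiently small» (reader/typer r13 gen 7; SKELETON rows B16.Eq1.78 / B16.Txt@383) -/

/-- **p. 383 [29], the display after (1.78), PROVED** (render p029): *"… yield the following large field factor:
exp(−½γ₀[6(d + 3)(100M(L + 1)N^{β₀}R_j)^{d+2}]⁻¹A₁²p₁(g_j)) < exp(−R_j^{−d−5}p₁²(g_j))"* — in the corrected reading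
`p₁(g_j) ↦ p₁²(g_j)` of the left exponent (cell slip note D-b02.7; `lfFactor178` with `p₁g' = p₁g²`): with `W =
6(d+3)(100M(L+1)N^{β₀}R_j)^{d+2}`, the comparison `½γ₀W⁻¹A₁²p₁² > R_j^{−d−5}p₁²` is EQUIVALENT to `12(d+3)(100M(L+1)N^{β₀})^{d+2}
< γ₀A₁²R_j³` (for `p₁(g_j) ≠ 0`, `R_j > 0`), which is the explicit form of the smallness of `g_j` (`R_j = (log g_j⁻²)^{r₀} →
∞` while `N^{β₀} ≦ R_j^{β₀}`, `β₀(d + 2) < 3`); under that hypothesis (`hlarge`) the display holds. [cite: Balaban1989LargeFieldII, p.383 (after (1.78))] -/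
theorem lfFactor178_of_large {γ₀ A₁ p₁g Rj M L Nβ : ℝ} {d : ℕ} (hRj : 0 < Rj) (hp : p₁g ≠ 0)
    (hbase : 0 < 100 * M * (L + 1) * Nβ)
    (hlarge : 12 * (d + 3) * (100 * M * (L + 1) * Nβ) ^ (d + 2) < γ₀ * A₁ ^ 2 * Rj ^ 3) :
    lfFactor178 γ₀ (6 * (d + 3) * (100 * M * (L + 1) * Nβ * Rj) ^ (d + 2)) A₁ (p₁g ^ 2) p₁g Rj d := by
  unfold lfFactor178
  rw [Real.exp_lt_exp]
  have hp2 : 0 < p₁g ^ 2 := by positivity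
  have hB : 0 < (100 * M * (L + 1) * Nβ) ^ (d + 2) := pow_pos hbase _
  have hW : 0 < 6 * ((d : ℝ) + 3) * (100 * M * (L + 1) * Nβ * Rj) ^ (d + 2) := by positivity
  have hR5 : 0 < Rj ^ (d + 5) := pow_pos hRj _
  -- reduce to the comparison of the two coefficients of `p₁g²`
  have key : (Rj ^ (d + 5))⁻¹ < 1 / 2 * γ₀ * (6 * ((d : ℝ) + 3) * (100 * M * (L + 1) * Nβ * Rj) ^ (d + 2))⁻¹ * A₁ ^ 2 := by
    rw [show 1 / 2 * γ₀ * (6 * ((d : ℝ) + 3) * (100 * M * (L + 1) * Nβ * Rj) ^ (d + 2))⁻¹ * A₁ ^ 2 =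
        (γ₀ * A₁ ^ 2) / (12 * ((d : ℝ) + 3) * (100 * M * (L + 1) * Nβ * Rj) ^ (d + 2)) by
      field_simp; ring]
    rw [inv_eq_one_div, div_lt_div_iff₀ hR5 (by positivity), one_mul]
    calc 12 * ((d : ℝ) + 3) * (100 * M * (L + 1) * Nβ * Rj) ^ (d + 2)
        = 12 * ((d : ℝ) + 3) * (100 * M * (L + 1) * Nβ) ^ (d + 2) * Rj ^ (d + 2) := by rw [mul_pow]; ring
      _ < γ₀ * A₁ ^ 2 * Rj ^ 3 * Rj ^ (d + 2) := mul_lt_mul_of_pos_right hlarge (pow_pos hRj _)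
      _ = γ₀ * A₁ ^ 2 * Rj ^ (d + 5) := by rw [show d + 5 = 3 + (d + 2) by omega, pow_add]; ring
  have h := mul_lt_mul_of_pos_right key hp2
  linarith

/-- The largeness hypothesis `hlarge` is monotone in the bound used for `N^{β₀}`: with the N-window `N ≦ R_j` (p. 361,
`NWindowUpper`) one bounds `N^{β₀}` by some `K` (e.g. `R_j^{β₀}`), and `12(d+3)(100M(L+1)K)^{d+2} < γ₀A₁²R_j³` — true for
`g_j` small since `R_j = (log g_j⁻²)^{r₀} → ∞` and `β₀(d + 2) < 3` — gives `hlarge`. PROVED (monotonicity).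
[cite: Balaban1989LargeFieldII, p.383 (after (1.78))] -/
theorem large_of_window {γ₀ A₁ Rj M L Nβ K : ℝ} {d : ℕ} (hM : 0 ≤ M) (hL : 0 ≤ L + 1) (hN : 0 ≤ Nβ) (hNK : Nβ ≤ K)
    (hK : 12 * (d + 3) * (100 * M * (L + 1) * K) ^ (d + 2) < γ₀ * A₁ ^ 2 * Rj ^ 3) :
    12 * (d + 3) * (100 * M * (L + 1) * Nβ) ^ (d + 2) < γ₀ * A₁ ^ 2 * Rj ^ 3 := by
  have h1 : 100 * M * (L + 1) * Nβ ≤ 100 * M * (L + 1) * K :=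
    mul_le_mul_of_nonneg_left hNK (by positivity)
  have h2 : (100 * M * (L + 1) * Nβ) ^ (d + 2) ≤ (100 * M * (L + 1) * K) ^ (d + 2) :=
    pow_le_pow_left₀ (by positivity) h1 _
  have h3 : 12 * ((d : ℝ) + 3) * (100 * M * (L + 1) * Nβ) ^ (d + 2) ≤
      12 * ((d : ℝ) + 3) * (100 * M * (L + 1) * K) ^ (d + 2) := mul_le_mul_of_nonneg_left h2 (by positivity)
  exact lt_of_le_of_lt h3 hK

end Literature.MathematicalPhysics.QuantumFieldTheory.Balaban1983to89.B16Sect1Kernels
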